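import Literature.Computability.Cryptography.HallgrenClassGroupQuantumSuccess
import Literature.Computability.Cryptography.HallgrenClassGroupOrderInj
import Literature.Computability.Cryptography.HallgrenClassGroupDiscriminant
import Literature.Computability.Cryptography.ShorModExpBlock
import Literature.Computability.Complexity.ZIntBricks
import HarnessLib

/-!
# Hallgren 2005 / class numbers under GRH — step Q2d (iii-b): instances, the block semantics in
# terms of forms, and the on-promise success bound of the family (every negative discriminant)

Topic `Literature/Computability/Cryptography`; proof companion of `HallgrenClassGroup.lean`
(named fact `Hallgren2005_classNumber_qsolvable_of_GRH`). Real definitions and theorems; no named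
fact. The class-group twin of the §§"family / instances / kernel" parts of
`ShorDiscreteLogQuantum.lean`, over the form class group of an ARBITRARY negative discriminant
(`HallgrenClassGroupOrder.lean`, `HallgrenClassGroupOrderInj.lean`: classes `classOf' Δ f ∈ Cl(O_D)`),
so that the promise of the quantum sub-language is polynomial-time checkable:

* instances `(d, L)` — `D = −d < 0`, `D ≡ 0, 1 (mod 4)`, `L` a list of reduced primitive forms of
  discriminant `D` — their encoding `encodeClInstance`, the promise `IsClInstance`, and the answer
  **`clGenOrder d L`** (`FormComposition.genOrder`, field-free: the number of forms generated by `L`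
  under composition) with **`genOrder_eq_card_closure'`**: it is the order of the subgroup of
  `Cl(O_D)` generated by the classes of `L`;
* the semantics the clean block must have, in terms of forms only: `slotForm`, `ctrlExp`,
  **`trialForm d L ℓ c t = reduce(∏_i slotForm_i^{E_{t,i}(c)})`**, and its class
  (`classOf'_trialForm`);
* the family `kitaevClFamily`, `clReadControls`;
* **`kernelProb_clOrderEst_ge`**: on an instance, for ANY clean block whose work register separates
  exactly the trial forms, the family outputs with probability `≥ 77/96` a string whose control bits
  `γ` satisfy `clOrderEst ℓ γ = clGenOrder d L` (`subgroupOrder_success` for the finite subgroup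
  `G = ⟨[slotForm_i]⟩ ≤ redClasses ≤ Cl(O_D)`, `|G| ≤ h(D) ≤ d² < 4^ℓ`, and `clOrderEst_eq_card`).

## References

* A. Yu. Kitaev, arXiv:quant-ph/9511026 (1995), §3–§4 [Kitaev1995].
* S. Hallgren, STOC 2005, §4; A. M. Childs, W. van Dam, Rev. Mod. Phys. 82 (2010), §5.7
  [ChildsVandam2010].
* D. A. Cox, *Primes of the form x² + ny²*, 2nd ed. (2013), §3.A, §7.B Thm. 7.7 [Cox2013].
-/

noncomputable section

open scoped QuadraticAlgebra

namespace Literature.Computability.Cryptography.Hallgren2005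

open _root_.Computability Complexity Complex Finset Real Matrix Kitaev1995 QuantumComplexity
open Literature.NumberTheory.QuadraticFields.Quadratic Literature.NumberTheory.QuadraticFields.Quadratic.BinQF
open Literature.NumberTheory.QuadraticFields.BinaryQuadraticForm (reducedForms mem_reducedForms_of_isPosPrim_of_isReduced)
open FormComposition Reduction OrderCl

/-! ### Instances -/

/-- A form `(a, b, c)` transported from the instance format. [folklore] -/
def toForm (q : ℕ × ℤ × ℕ) : BinQF := ⟨q.1, q.2.1, q.2.2⟩

/-- The code of a form `(a, b, c)`: the record `⟨bin a, ⟨dp b, bin c⟩⟩` (`dp` = the canonical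
difference-pair code of a signed integer, `Brick.dpEnc`). [folklore] -/
def formCode (q : ℕ × ℤ × ℕ) : List Bool :=
  boolPair (encodeNat q.1) (boolPair (Complexity.Brick.dpEnc q.2.1) (encodeNat q.2.2))

/-- **The encoded instance** `⟨bin d, encList [formCode q₁, …]⟩` (records and coded lists, the
native formats of the tree's `FP` brick algebra). [folklore] -/
def encodeClInstance (d : ℕ) (L : List (ℕ × ℤ × ℕ)) : List Bool :=
  boolPair (encodeNat d) (encList (L.map formCode))

/-- `formCode` is injective. [folklore] -/
theorem formCode_injective : Function.Injective formCode := by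
  rintro ⟨a, b, c⟩ ⟨a', b', c'⟩ h
  obtain ⟨h1, h2⟩ := QCircuit.boolPair_inj h
  obtain ⟨h3, h4⟩ := QCircuit.boolPair_inj h2
  simp only at h1 h3 h4
  obtain rfl := QCircuit.encodeNat_injective h1
  obtain rfl := Complexity.Brick.dpEnc_injective h3
  obtain rfl := QCircuit.encodeNat_injective h4
  rfl

/-- A list is no longer than its code inside the instance. [folklore] -/
theorem length_le_length_encodeClInstance (d : ℕ) (L : List (ℕ × ℤ × ℕ)) :
    L.length ≤ (encodeClInstance d L).length := by
  rw [encodeClInstance, length_boolPair, length_encList, List.map_map]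
  have key : ∀ l : List (ℕ × ℤ × ℕ), l.length ≤ (l.map ((fun a => 2 * a.length + 2) ∘ formCode)).sum := by
    intro l
    induction l with
    | nil => simp
    | cons x l ih => simp only [List.length_cons, List.map_cons, List.sum_cons, Function.comp]; omega
  have := key L
  omega

/-- **The promise** (polynomial-time checkable): `D = −d` is a negative discriminant
(`d > 0`, `D ≡ 0, 1 (mod 4)`) and the members of `L` are reduced primitive positive definite forms
of discriminant `D`. (No fundamentality: the sub-problem is about the form class group of an
ARBITRARY negative discriminant, `HallgrenClassGroupOrder*.lean`.)
[cite: ChildsVandam2010, §5.7 (the class group by generators)] -/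
def IsClInstance (d : ℕ) (L : List (ℕ × ℤ × ℕ)) : Prop :=
  0 < d ∧ ((-(d : ℤ)) % 4 = 0 ∨ (-(d : ℤ)) % 4 = 1) ∧
    ∀ q ∈ L, (toForm q).IsPosPrim (-(d : ℤ)) ∧ (toForm q).IsReduced

/-- The bundled negative discriminant `−d` of an instance. [folklore] -/
def negDiscrOf {d : ℕ} (hd : 0 < d) : OrderCl.NegDiscr := ⟨-(d : ℤ), by omega⟩

/-- **The answer of the quantum sub-problem**: the order of the subgroup of the form class group
`Cl(−d)` generated by the forms of `L` (field-free, `FormComposition.genOrder`). [cite: ChildsVandam2010, §5.7] -/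
def clGenOrder (d : ℕ) (L : List (ℕ × ℤ × ℕ)) : ℕ := genOrder (-(d : ℤ)) (L.map toForm)

/-- The instance encoding is injective (curried). [folklore] -/
theorem encodeClInstance_inj {d d' : ℕ} {L L' : List (ℕ × ℤ × ℕ)}
    (h : encodeClInstance d L = encodeClInstance d' L') : d = d' ∧ L = L' := by
  obtain ⟨h1, h2⟩ := QCircuit.boolPair_inj h
  exact ⟨QCircuit.encodeNat_injective h1,
    List.map_injective_iff.2 formCode_injective (ModExpBlock.encList_injective h2)⟩

/-- `d < 2^ℓ` for the encoded length `ℓ`. [folklore] -/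
theorem lt_two_pow_length_encodeClInstance (d : ℕ) (L : List (ℕ × ℤ × ℕ)) :
    d < 2 ^ (encodeClInstance d L).length := by
  have h1 : d < 2 ^ (encodeNat d).length := by simpa using bitsToNat_lt (encodeNat d)
  have h2 : (encodeNat d).length ≤ (encodeClInstance d L).length := by
    rw [encodeClInstance, length_boolPair]; omega
  exact lt_of_lt_of_le h1 (Nat.pow_le_pow_right (by norm_num) h2)

/-! ### The semantics of the block in terms of forms -/

/-- The generator of slot `i`: the `i`-th form of `L`, or the principal form. [folklore] -/
def slotForm (d : ℕ) (L : List (ℕ × ℤ × ℕ)) (i : ℕ) : BinQF :=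
  if h : i < L.length then toForm (L.get ⟨i, h⟩) else FormComposition.one (-(d : ℤ))

/-- The exponent carried by the controls of trial `t` and slot `i`:
`E_{t,i}(c) = ∑_{j : trial j = t, slot j = i} c_j 2^{level j}`. [cite: Kitaev1995, §3 (Lemma 10)] -/
def ctrlExp (ℓ : ℕ) (c : Fin (clNumControls ℓ) → Bool) (t : Fin (clTrials ℓ)) (i : Fin (clSlots ℓ)) : ℕ :=
  ∑ j ∈ univ.filter (fun j => clTrialOf ℓ j = t ∧ clSlotOf ℓ j = i),
    if c j then 2 ^ (clLevelOf ℓ j : ℕ) else 0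

/-- One slot of the trial product: compose the accumulator with `slotForm_i ^ E_{t,i}(c)`. [folklore] -/
def trialStep (d : ℕ) (L : List (ℕ × ℤ × ℕ)) (ℓ : ℕ) (c : Fin (clNumControls ℓ) → Bool)
    (t : Fin (clTrials ℓ)) (acc : BinQF) (i : Fin (clSlots ℓ)) : BinQF :=
  compose (-(d : ℤ)) acc (formPow (-(d : ℤ)) (slotForm d L i) (ctrlExp ℓ c t i))

/-- **The form of trial `t`**: the reduced representative of `∏_i [slotForm_i]^{E_{t,i}(c)}`,
computed slot by slot. This is what the clean block writes into the target register of trial `t`.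
[cite: Kitaev1995, §4 (the permutations V_j on shared registers); ChildsVandam2010, §5.7] -/
def trialForm (d : ℕ) (L : List (ℕ × ℤ × ℕ)) (ℓ : ℕ) (c : Fin (clNumControls ℓ) → Bool)
    (t : Fin (clTrials ℓ)) : BinQF :=
  (List.finRange (clSlots ℓ)).foldl (trialStep d L ℓ c t) (FormComposition.one (-(d : ℤ)))

/-! ### The family and the read-out of the controls -/

/-- Kitaev's family for the subgroup-order experiment around blocks `V ℓ` with `mW ℓ` work wires.
[cite: Kitaev1995, §3 (Remark 8, Lemma 10) and §4] -/
def kitaevClFamily (mW : ℕ → ℕ) (V : (ℓ : ℕ) → QCircuit cliffordT (ℓ + (clNumControls ℓ + mW ℓ))) :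
    QCircuitFamily cliffordT :=
  ⟨fun ℓ => clNumControls ℓ + mW ℓ, fun ℓ => kitaevCircuit (V ℓ) (clTypeOf ℓ)⟩

/-- The family is oracle-free if its blocks are. [folklore] -/
theorem kitaevClFamily_isOracleFree {mW : ℕ → ℕ}
    {V : (ℓ : ℕ) → QCircuit cliffordT (ℓ + (clNumControls ℓ + mW ℓ))} (hV : ∀ ℓ, (V ℓ).IsOracleFree) :
    (kitaevClFamily mW V).IsOracleFree := fun ℓ =>
  kitaevCircuit_isOracleFree (hV ℓ) _

/-- The control bits of a measured output string (wires `ℓ, …, ℓ + clNumControls ℓ − 1`). [folklore] -/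
def clReadControls (ℓ : ℕ) (y : List Bool) : Fin (clNumControls ℓ) → Bool :=
  fun j => y.getD (ℓ + j) false

/-- Reading the controls off the read-out of a label `x γ ρ` gives `γ`. [folklore] -/
theorem clReadControls_ofFn_tri {ℓ m : ℕ} (x : QReg ℓ) (γ : Fin (clNumControls ℓ) → Bool)
    (ρ : QReg m) : clReadControls ℓ (List.ofFn (tri x γ ρ)) = γ := by
  funext j
  have hj : ℓ + (j : ℕ) < ℓ + (clNumControls ℓ + m) := by have := j.isLt; omega
  rw [clReadControls, List.getD_eq_getElem?_getD, List.getElem?_ofFn]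
  simp only [hj, dite_true, Option.getD_some]
  have : (⟨ℓ + (j : ℕ), hj⟩ : Fin (ℓ + (clNumControls ℓ + m))) = coinWire ℓ (clNumControls ℓ) m j :=
    Fin.ext (by rw [val_coinWire])
  rw [this, tri_coinWire]

/-- Regrouping the trial sum by slots: `∑_{j ∈ trial t} c_j 2^{l_j} g_{i_j} = ∑_i E_{t,i}(c) g_i`.
[folklore] -/
theorem sum_trial_eq_sum_ctrlExp_smul {ℓ : ℕ} {G : Type*} [AddCommGroup G] (g : Fin (clSlots ℓ) → G)
    (c : Fin (clNumControls ℓ) → Bool) (t : Fin (clTrials ℓ)) :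
    (∑ j ∈ univ.filter (fun j => clTrialOf ℓ j = t), (if c j then clW g j else 0)) =
      ∑ i : Fin (clSlots ℓ), ctrlExp ℓ c t i • g i := by
  classical
  rw [← Finset.sum_fiberwise_of_maps_to (g := clSlotOf ℓ) (t := univ) (fun _ _ => mem_univ _)]
  refine sum_congr rfl fun i _ => ?_
  rw [ctrlExp, Finset.sum_smul, filter_filter]
  refine sum_congr rfl fun j hj => ?_
  have hji : clSlotOf ℓ j = i := (mem_filter.1 hj).2.2
  by_cases hc : c j
  · simp [hc, clW, hji]
  · simp [hc]

/-! ### The dictionary forms ↔ classes in `Cl(O_D)` -/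

section Dictionary

variable (Δ : NegDiscr) {d : ℕ} {L : List (ℕ × ℤ × ℕ)}

/-- Slot generators are reduced primitive positive definite forms of discriminant `D = −d`. [folklore] -/
theorem slotForm_spec (hd : 0 < d) (hD4 : (-(d : ℤ)) % 4 = 0 ∨ (-(d : ℤ)) % 4 = 1)
    (hL : ∀ q ∈ L, (toForm q).IsPosPrim (-(d : ℤ)) ∧ (toForm q).IsReduced) (i : ℕ) :
    (slotForm d L i).IsPosPrim (negDiscrOf hd).D ∧ (slotForm d L i).IsReduced := by
  rw [slotForm]
  split_ifs with h
  · exact hL _ (List.get_mem L ⟨i, h⟩)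
  · exact isPosPrim_one (negDiscrOf hd).neg hD4

/-- Generated forms are reduced primitive positive definite with class in the closure. [folklore] -/
theorem genForms_spec' {L' : List BinQF} (hL : ∀ f ∈ L', f.IsPosPrim Δ.D ∧ f.IsReduced)
    (hD4 : Δ.D % 4 = 0 ∨ Δ.D % 4 = 1) {f : BinQF} (hf : GenForms Δ.D L' f) :
    f.IsPosPrim Δ.D ∧ f.IsReduced ∧ classOf' Δ f ∈ Subgroup.closure ((classOf' Δ) '' {g | g ∈ L'}) := by
  induction hf with
  | one =>
    obtain ⟨h1, h2⟩ := isPosPrim_one Δ.neg hD4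
    exact ⟨h1, h2, by rw [classOf'_one Δ hD4]; exact one_mem _⟩
  | mem h => exact ⟨(hL _ h).1, (hL _ h).2, Subgroup.subset_closure ⟨_, h, rfl⟩⟩
  | mul _ _ ihf ihg =>
    exact ⟨isPosPrim_compose' Δ ihf.1 ihg.1, isReduced_compose' Δ ihf.1 ihg.1,
      by rw [classOf'_compose Δ ihf.1 ihg.1]; exact mul_mem ihf.2.2 ihg.2.2⟩

/-- Every class in the closure is the class of a generated form. [folklore] -/
theorem exists_genForms_of_mem_closure' {L' : List BinQF} (hL : ∀ f ∈ L', f.IsPosPrim Δ.D ∧ f.IsReduced)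
    (hD4 : Δ.D % 4 = 0 ∨ Δ.D % 4 = 1) {c : ClassGroup (QO Δ)}
    (hc : c ∈ Subgroup.closure ((classOf' Δ) '' {g | g ∈ L'})) :
    ∃ f : BinQF, GenForms Δ.D L' f ∧ classOf' Δ f = c := by
  have hpow : ∀ {f : BinQF}, GenForms Δ.D L' f → ∀ n : ℕ, ∃ g, GenForms Δ.D L' g ∧
      classOf' Δ g = classOf' Δ f ^ n := by
    intro f hf n
    induction n with
    | zero => exact ⟨FormComposition.one Δ.D, GenForms.one, by rw [pow_zero, classOf'_one Δ hD4]⟩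
    | succ n ih =>
      obtain ⟨g, hg, hgc⟩ := ih
      have hgs := genForms_spec' Δ hL hD4 hg
      have hfs := genForms_spec' Δ hL hD4 hf
      exact ⟨compose Δ.D g f, GenForms.mul hg hf, by rw [classOf'_compose Δ hgs.1 hfs.1, hgc, pow_succ]⟩
  -- finite order of every class of a generated form
  have hfin : ∀ {f : BinQF}, GenForms Δ.D L' f → 0 < orderOf (classOf' Δ f) := by
    intro f hf
    have hmem : classOf' Δ f ∈ redClasses Δ := classOf'_mem_redClasses Δ (genForms_spec' Δ hL hD4 hf).1
    have h := (isOfFinOrder_of_finite (⟨classOf' Δ f, hmem⟩ : redClasses Δ)).orderOf_pos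
    rw [← Subgroup.orderOf_coe] at h
    exact h
  induction hc using Subgroup.closure_induction with
  | mem x hx =>
    obtain ⟨g, hg, rfl⟩ := hx
    exact ⟨g, GenForms.mem hg, rfl⟩
  | one => exact ⟨FormComposition.one Δ.D, GenForms.one, classOf'_one Δ hD4⟩
  | mul x y _ _ hx hy =>
    obtain ⟨f, hf, rfl⟩ := hx
    obtain ⟨g, hg, rfl⟩ := hy
    have hfs := genForms_spec' Δ hL hD4 hf
    have hgs := genForms_spec' Δ hL hD4 hg
    exact ⟨compose Δ.D f g, GenForms.mul hf hg, classOf'_compose Δ hfs.1 hgs.1⟩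
  | inv x _ hx =>
    obtain ⟨f, hf, rfl⟩ := hx
    have ho : 0 < orderOf (classOf' Δ f) := hfin hf
    have hord := pow_orderOf_eq_one (classOf' Δ f)
    obtain ⟨g, hg, hgc⟩ := hpow hf (orderOf (classOf' Δ f) - 1)
    refine ⟨g, hg, ?_⟩
    rw [hgc]
    refine eq_inv_of_mul_eq_one_left ?_
    rw [← pow_succ, Nat.sub_add_cancel ho, hord]

/-- **`genOrder D L'` is the order of the subgroup of `Cl(O_D)` generated by the classes of `L'`.**
[cite: Cox2013, §7.B Thm. 7.7(ii)] -/
theorem genOrder_eq_card_closure' {L' : List BinQF} (hL : ∀ f ∈ L', f.IsPosPrim Δ.D ∧ f.IsReduced)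
    (hD4 : Δ.D % 4 = 0 ∨ Δ.D % 4 = 1) :
    genOrder Δ.D L' = Nat.card (Subgroup.closure ((classOf' Δ) '' {g | g ∈ L'})) := by
  rw [genOrder]
  refine Nat.card_congr (Equiv.ofBijective
    (fun f => ⟨classOf' Δ f.1, (genForms_spec' Δ hL hD4 f.2).2.2⟩) ⟨?_, ?_⟩)
  · rintro ⟨f, hf⟩ ⟨g, hg⟩ h
    have hfs := genForms_spec' Δ hL hD4 hf
    have hgs := genForms_spec' Δ hL hD4 hg
    exact Subtype.ext (classOf'_inj Δ hfs.1 hgs.1 hfs.2.1 hgs.2.1 (congrArg Subtype.val h))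
  · rintro ⟨c, hc⟩
    obtain ⟨f, hf, hfc⟩ := exists_genForms_of_mem_closure' Δ hL hD4 hc
    exact ⟨⟨f, hf⟩, Subtype.ext hfc⟩

/-- The closure of classes of valid forms lies in `redClasses`, hence has at most `h(D)` elements.
[cite: Cox2013, §2.A Thm. 2.13] -/
theorem card_closure_le_classNumber (S : Set BinQF) (hS : ∀ f ∈ S, f.IsPosPrim Δ.D)
    (hD4 : Δ.D % 4 = 0 ∨ Δ.D % 4 = 1) :
    Nat.card (Subgroup.closure ((classOf' Δ) '' S)) ≤
      Literature.NumberTheory.QuadraticFields.BinaryQuadraticForm.classNumber Δ.D := by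
  classical
  -- the closure is contained in the image of `reducedForms D`
  set img := (reducedForms Δ.D).image fun Q : ℤ × ℤ × ℤ => classOf' Δ ⟨Q.1, Q.2.1, Q.2.2⟩ with himg
  have hsub : (Subgroup.closure ((classOf' Δ) '' S) : Set (ClassGroup (QO Δ))) ⊆ img := by
    intro c hc
    have hc' : c ∈ redClasses Δ := by
      refine (Subgroup.closure_le (redClasses Δ)).2 ?_ hc
      rintro _ ⟨f, hf, rfl⟩
      exact classOf'_mem_redClasses Δ (hS f hf)
    rcases hc' with rfl | ⟨f, hf, hfr, rfl⟩
    · obtain ⟨h1, h2⟩ := isPosPrim_one Δ.neg hD4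
      rw [himg, Finset.coe_image]
      refine ⟨((FormComposition.one Δ.D).a, (FormComposition.one Δ.D).b, (FormComposition.one Δ.D).c),
        mem_reducedForms_of_isPosPrim_of_isReduced Δ.neg h1 h2, ?_⟩
      exact classOf'_one Δ hD4
    · rw [himg, Finset.coe_image]
      exact ⟨(f.a, f.b, f.c), mem_reducedForms_of_isPosPrim_of_isReduced Δ.neg hf hfr, rfl⟩
  have hfin : (img : Set (ClassGroup (QO Δ))).Finite := img.finite_toSet
  calc Nat.card (Subgroup.closure ((classOf' Δ) '' S))
      = Nat.card ((Subgroup.closure ((classOf' Δ) '' S) : Set (ClassGroup (QO Δ)))) := rfl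
    _ ≤ Nat.card (img : Set (ClassGroup (QO Δ))) := Nat.card_mono hfin hsub
    _ = img.card := by rw [Finset.coe_sort_coe, Nat.card_eq_finsetCard]
    _ ≤ (reducedForms Δ.D).card := Finset.card_image_le
    _ = _ := rfl

/-- **The class of the trial form**: `[trialForm c t] = ∏_i [slotForm_i]^{E_{t,i}(c)}` in `Cl(O_D)`,
and the trial form is reduced primitive positive definite. [cite: Cox2013, §7.B Thm. 7.7 and §3.A] -/
theorem classOf'_trialForm (hd : 0 < d) (hD4 : (-(d : ℤ)) % 4 = 0 ∨ (-(d : ℤ)) % 4 = 1)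
    (hL : ∀ q ∈ L, (toForm q).IsPosPrim (-(d : ℤ)) ∧ (toForm q).IsReduced) (ℓ : ℕ)
    (c : Fin (clNumControls ℓ) → Bool) (t : Fin (clTrials ℓ)) :
    (trialForm d L ℓ c t).IsPosPrim (negDiscrOf hd).D ∧ (trialForm d L ℓ c t).IsReduced ∧
      classOf' (negDiscrOf hd) (trialForm d L ℓ c t) =
        ∏ i : Fin (clSlots ℓ), classOf' (negDiscrOf hd) (slotForm d L i) ^ ctrlExp ℓ c t i := by
  set Δ := negDiscrOf hd with hΔ
  have key : ∀ (l : List (Fin (clSlots ℓ))) (acc : BinQF), acc.IsPosPrim Δ.D → acc.IsReduced →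
      (l.foldl (trialStep d L ℓ c t) acc).IsPosPrim Δ.D ∧ (l.foldl (trialStep d L ℓ c t) acc).IsReduced ∧
        classOf' Δ (l.foldl (trialStep d L ℓ c t) acc) =
          classOf' Δ acc *
            (l.map fun i : Fin (clSlots ℓ) => classOf' Δ (slotForm d L i) ^ ctrlExp ℓ c t i).prod := by
    intro l
    induction l with
    | nil => intro acc h1 h2; exact ⟨h1, h2, by simp⟩
    | cons i l ih =>
      intro acc h1 h2
      obtain ⟨hp, hr, hc⟩ := formPow_spec' Δ (slotForm_spec hd hD4 hL i).1 (ctrlExp ℓ c t i)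
      have hstep1 : (trialStep d L ℓ c t acc i).IsPosPrim Δ.D := isPosPrim_compose' Δ h1 hp
      have hstep2 : (trialStep d L ℓ c t acc i).IsReduced := isReduced_compose' Δ h1 hp
      obtain ⟨g1, g2, g3⟩ := ih _ hstep1 hstep2
      refine ⟨g1, g2, ?_⟩
      rw [List.foldl_cons, g3, List.map_cons, List.prod_cons, ← mul_assoc]
      congr 1
      rw [← hc]
      exact classOf'_compose Δ h1 hp
  obtain ⟨o1, o2⟩ := isPosPrim_one Δ.neg hD4
  obtain ⟨g1, g2, g3⟩ := key (List.finRange (clSlots ℓ)) (FormComposition.one Δ.D) o1 o2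
  refine ⟨g1, g2, ?_⟩
  show classOf' Δ ((List.finRange (clSlots ℓ)).foldl (trialStep d L ℓ c t) (FormComposition.one Δ.D)) = _
  rw [g3, classOf'_one Δ hD4, one_mul, Fin.prod_univ_def]

end Dictionary

/-! ### The on-promise success bound -/

/-- **The on-promise bound.** On an instance `(d, L)`, Kitaev's family around ANY clean block whose
work register separates exactly the trial forms outputs, with probability `≥ 77/96`, a string whose
control bits `γ` give `clOrderEst ℓ γ = clGenOrder d L`. [cite: Kitaev1995, §3–§4; ChildsVandam2010, §5.7] -/
theorem kernelProb_clOrderEst_ge {mW : ℕ → ℕ}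
    {V : (ℓ : ℕ) → QCircuit cliffordT (ℓ + (clNumControls ℓ + mW ℓ))} (d : ℕ) (L : List (ℕ × ℤ × ℕ))
    (hinst : IsClInstance d L)
    (R : QReg (clNumControls (encodeClInstance d L).length) → QReg (mW (encodeClInstance d L).length))
    (hV : ∀ c, (V (encodeClInstance d L).length).toMatrix 0 *ᵥ
        basisState (coinInput (encodeClInstance d L).get c) =
          basisState (tri (encodeClInstance d L).get c (R c)))
    (hR : ∀ c c', R c = R c' ↔ ∀ t,
      trialForm d L (encodeClInstance d L).length c t = trialForm d L (encodeClInstance d L).length c' t) :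
    77 / 96 ≤ (kitaevClFamily mW V).kernelProb 0 (encodeClInstance d L)
      {z | clOrderEst (encodeClInstance d L).length (clReadControls (encodeClInstance d L).length z) =
        clGenOrder d L} := by
  classical
  obtain ⟨hdpos, hD4, hL⟩ := hinst
  have hlen := length_le_length_encodeClInstance d L
  have hdlt := lt_two_pow_length_encodeClInstance d L
  revert R hV hR hlen hdlt
  generalize encodeClInstance d L = w
  intro R hV hR hlen hdlt
  -- the order `O_D`, `D = −d`
  set Δ : NegDiscr := negDiscrOf hdpos with hΔdef
  have hΔ : Δ.D = -(d : ℤ) := rfl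
  -- the group `G = ⟨[slotForm_i]⟩ ≤ Cl(O_D)`, additively
  let gcl : Fin (clSlots w.length) → Additive (ClassGroup (QO Δ)) :=
    fun i => Additive.ofMul (classOf' Δ (slotForm d L i))
  let H := AddSubgroup.closure (Set.range gcl)
  -- `H` is finite: it corresponds to the closure in `Cl(O_D)`, contained in `redClasses`
  have hHmul : H = (Subgroup.closure (Set.range fun i : Fin (clSlots w.length) =>
      classOf' Δ (slotForm d L i))).toAddSubgroup := by
    have : (Set.range gcl) =
        Additive.toMul ⁻¹' (Set.range fun i : Fin (clSlots w.length) => classOf' Δ (slotForm d L i)) := by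
      ext x
      simp only [Set.mem_range, Set.mem_preimage]
      constructor
      · rintro ⟨i, rfl⟩; exact ⟨i, rfl⟩
      · rintro ⟨i, hi⟩; exact ⟨i, by rw [← ofMul_toMul x, ← hi]⟩
    show AddSubgroup.closure (Set.range gcl) = _
    rw [this, ← Subgroup.toAddSubgroup_closure]
  have hslotpp : ∀ i : ℕ, (slotForm d L i).IsPosPrim Δ.D := fun i => (slotForm_spec hdpos hD4 hL i).1
  have hrange_eq : (Set.range fun i : Fin (clSlots w.length) => classOf' Δ (slotForm d L i)) =
      (classOf' Δ) '' (Set.range fun i : Fin (clSlots w.length) => slotForm d L i) := by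
    ext c; simp [Set.mem_range, Set.mem_image]
  have hcard_le : Nat.card H ≤ Literature.NumberTheory.QuadraticFields.BinaryQuadraticForm.classNumber Δ.D := by
    rw [hHmul]
    show Nat.card (Subgroup.closure (Set.range fun i : Fin (clSlots w.length) => classOf' Δ (slotForm d L i))) ≤ _
    rw [hrange_eq]
    exact card_closure_le_classNumber Δ _ (by rintro _ ⟨i, rfl⟩; exact hslotpp i) hD4
  -- `H` is finite (inside the finite `redClasses`)
  have hfinset : Set.Finite ((Subgroup.closure (Set.range fun i : Fin (clSlots w.length) =>
      classOf' Δ (slotForm d L i))) : Set (ClassGroup (QO Δ))) := by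
    refine (finite_redClasses Δ).subset ?_
    intro c hc
    refine (Subgroup.closure_le (redClasses Δ)).2 ?_ hc
    rintro _ ⟨i, rfl⟩
    exact classOf'_mem_redClasses Δ (hslotpp i)
  have hHfin : Set.Finite (H : Set (Additive (ClassGroup (QO Δ)))) := by
    have hset : (H : Set (Additive (ClassGroup (QO Δ)))) = Additive.toMul ⁻¹'
        ((Subgroup.closure (Set.range fun i : Fin (clSlots w.length) => classOf' Δ (slotForm d L i))) :
          Set (ClassGroup (QO Δ))) := by
      rw [hHmul]; ext x; simp
    rw [hset]
    exact hfinset.preimage Additive.toMul.injective.injOn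
  haveI : Finite H := hHfin.to_subtype
  haveI : Fintype H := Fintype.ofFinite H
  let g : Fin (clSlots w.length) → H := fun i => ⟨gcl i, AddSubgroup.subset_closure ⟨i, rfl⟩⟩
  have hgtop : AddSubgroup.closure (Set.range g) = ⊤ := by
    have := AddSubgroup.closure_closure_coe_preimage (k := Set.range gcl)
    rw [← this]
    congr 1
    ext x
    simp only [Set.mem_range, Set.mem_preimage]
    constructor
    · rintro ⟨i, rfl⟩; exact ⟨i, rfl⟩
    · rintro ⟨i, hi⟩; exact ⟨i, Subtype.ext hi⟩
  -- `|G| = clGenOrder d L`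
  have hslots : ∀ q ∈ L, ∃ i : Fin (clSlots w.length), slotForm d L i = toForm q := by
    intro q hq
    obtain ⟨k, hk, rfl⟩ := List.getElem_of_mem hq
    refine ⟨⟨k, lt_of_lt_of_le hk hlen⟩, ?_⟩
    simp [slotForm, hk]
  have hLK : ∀ f ∈ L.map toForm, f.IsPosPrim Δ.D ∧ f.IsReduced := by
    intro f hf
    obtain ⟨q, hq, rfl⟩ := List.mem_map.1 hf
    rw [hΔ]; exact hL q hq
  have hclosure : Subgroup.closure ((classOf' Δ) '' {f | f ∈ L.map toForm}) =
      Subgroup.closure (Set.range fun i : Fin (clSlots w.length) => classOf' Δ (slotForm d L i)) := by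
    apply le_antisymm
    · refine (Subgroup.closure_le _).2 ?_
      rintro _ ⟨f, hf, rfl⟩
      obtain ⟨q, hq, rfl⟩ := List.mem_map.1 hf
      obtain ⟨i, hi⟩ := hslots q hq
      exact Subgroup.subset_closure ⟨i, by show classOf' Δ (slotForm d L i) = _; rw [hi]⟩
    · refine (Subgroup.closure_le _).2 ?_
      rintro _ ⟨i, rfl⟩
      by_cases h : (i : ℕ) < L.length
      · refine Subgroup.subset_closure ⟨toForm (L.get ⟨i, h⟩), ?_, by simp [slotForm, h]⟩
        exact List.mem_map.2 ⟨_, List.get_mem L ⟨i, h⟩, rfl⟩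
      · show classOf' Δ (slotForm d L i) ∈ _
        simp only [slotForm, h, dite_false]
        rw [← hΔ, classOf'_one Δ hD4]
        exact one_mem _
  have hcardG : Fintype.card H = clGenOrder d L := by
    rw [clGenOrder, ← hΔ, genOrder_eq_card_closure' Δ hLK hD4, hclosure, ← Nat.card_eq_fintype_card, hHmul]
    rfl
  -- `|G| < 4^ℓ`
  have hGlt : Fintype.card H < clN w.length := by
    have h3 := classNumber_le_sq d
    rw [← Nat.card_eq_fintype_card, clN, pow_mul, show (2 : ℕ) ^ 2 = 4 by norm_num]
    calc Nat.card H ≤ d * d := hcard_le.trans h3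
      _ < 2 ^ w.length * 2 ^ w.length := Nat.mul_lt_mul'' hdlt hdlt
      _ = 4 ^ w.length := by rw [← mul_pow]; norm_num
  -- the separation hypothesis in terms of the trial sums in `G`
  have hclass : ∀ (c : Fin (clNumControls w.length) → Bool) (t : Fin (clTrials w.length)),
      ((∑ j ∈ univ.filter (fun j => clTrialOf w.length j = t), (if c j then clW g j else 0) : H) :
        Additive (ClassGroup (QO Δ))) = Additive.ofMul (classOf' Δ (trialForm d L w.length c t)) := by
    intro c t
    rw [sum_trial_eq_sum_ctrlExp_smul, (classOf'_trialForm hdpos hD4 hL w.length c t).2.2, ofMul_prod,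
      AddSubgroup.val_finsetSum]
    refine sum_congr rfl fun i _ => ?_
    rw [AddSubgroup.coe_nsmul, ofMul_pow]
  have hR' : ∀ y y' : QReg (clNumControls w.length), R y = R y' ↔
      ∀ t, (∑ j ∈ univ.filter (fun j => clTrialOf w.length j = t), (if y j then clW g j else 0)) =
        ∑ j ∈ univ.filter (fun j => clTrialOf w.length j = t), (if y' j then clW g j else 0) := by
    intro y y'
    rw [hR]
    refine forall_congr' fun t => ?_
    rw [← Subtype.coe_inj, hclass, hclass, Additive.ofMul.injective.eq_iff]
    constructor
    · intro h; rw [h]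
    · intro h
      have h1 := classOf'_trialForm hdpos hD4 hL w.length y t
      have h2 := classOf'_trialForm hdpos hD4 hL w.length y' t
      exact classOf'_inj Δ h1.1 h2.1 h1.2.1 h2.2.1 h
  -- the favourable control read-outs
  have hE1 : ∀ ψ : Fin (clTrials w.length) → AddChar H ℂ, AddSubgroup.closure (Set.range ψ) = ⊤ → ∀ γ,
      ClAccurate g ψ γ → γ ∈ univ.filter fun γ => clOrderEst w.length γ = clGenOrder d L :=
    fun ψ hψ γ hacc => mem_filter.2 ⟨mem_univ _, by
      rw [← hcardG]; exact clOrderEst_eq_card hgtop hGlt hψ hacc⟩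
  have hE2 : ∀ γ ∈ univ.filter (fun γ => clOrderEst w.length γ = clGenOrder d L), ∀ ρ : QReg (mW w.length),
      List.ofFn (tri w.get γ ρ) ∈
        {z | clOrderEst w.length (clReadControls w.length z) = clGenOrder d L} := by
    intro γ hγ ρ
    rw [Set.mem_setOf_eq, clReadControls_ofFn_tri, (mem_filter.1 hγ).2]
  have hsucc := subgroupOrder_success (V w.length) w.get R hV g hGlt hR' _ hE1
  have hle := sum_tri_le_sum_ite
    ((kitaevCircuit (V w.length) (clTypeOf w.length)).runOn 0
      (basisState (padInput w.get (clNumControls w.length + mW w.length))))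
    w.get _ _ hE2
  unfold QCircuitFamily.kernelProb QCircuitFamily.kernel
  change 77 / 96 ≤ ((((kitaevCircuit (V w.length) (clTypeOf w.length)).outputPMF 0 w.get).map
    List.ofFn).toOuterMeasure _).toReal
  rw [toReal_outputPMF_map_toOuterMeasure]
  linarith

end Literature.Computability.Cryptography.Hallgren2005

end
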